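import Literature.AlgebraicGeometry.Motives.AbelianVarietyBaseChangeSchemeMaps
import Literature.AlgebraicGeometry.Motives.AbelianVarietyBaseChangeTowerFst
import Literature.AlgebraicGeometry.Motives.FiberBaseChange
import HarnessLib

/-!
# Comparison morphisms of the base-change tower `k → k′ → S` that lie over the first projections are natural and
# monoidal; transport of `(X ×_k Y)`-charts (Görtz–Wedhorn I, Prop. 4.16, §(4.7)–(4.8), Cor. 4.19)

Topic `Literature/AlgebraicGeometry/Motives`, namespace `Literature.AlgebraicGeometry.Motives.AbelianVariety` (next to
`bcFunctor`, `bcFunctorTowerIso`, `AbelianVarietyBaseChangeSchemeMaps`, and the sibling `BaseChangeTowerMonoidal` which treats an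
ABSTRACT natural isomorphism `e : bcFunctor k L ⋙ bcFunctor L M ≅ bcFunctor k M`).  THEOREMS ONLY (no definition, no named fact,
no instance; net Literature debt 0).  Cell `hodgecm-mathlib` (D-0151), fan A, row III-0, F6 helper (iv) «tower coherence» in the
PULLBACK-EXPLICIT currency `baseChangeHomObjIsoOfComp (algebraMap k L) (algebraMap L ℂ) (algebraMap k ℂ) hτ` of the landed `G4ℂ`
(`Liu2021/AlbaneseBaseChangeComplexSplit`, whose `towerIso_naturality_of_fst` / `baseChangeHomObjIsoOfComp_hom_left_fst'` are the
`S = ℂ` cases of `map_map_comp_eq_comp_map_of_left_comp_fst` / `baseChangeHomObjIsoOfComp_algebraMap_hom_left_comp_fst` below).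

WHAT IS PROVED.  For the base-change functors `F = - ⊗_k k′`, `G = - ⊗_{k′} S`, `H = - ⊗_k S` (`bcFunctor`, Mathlib
`Over.pullback`, cartesian monoidal) and ANY morphisms `e_X : G (F X) ⟶ H X` «over the first projections»
(`e_X ≫ pr_X = pr_{F X} ≫ pr_X` on underlying schemes — the defining property of the transitivity isomorphism
`(X ⊗_k k′) ⊗_{k′} S ≅ X ⊗_k S`, Görtz–Wedhorn I Prop. 4.16; universes and fields arbitrary):
* `map_map_comp_eq_comp_map_of_left_comp_fst` — naturality `G (F f) ≫ e_Z = e_W ≫ H f`;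
* `μ_comp_map_μ_comp_eq_of_left_comp_fst` — MONOIDALITY `μ_G ≫ G(μ_F) ≫ e_{X ⊗ Y} = (e_X ⊗ e_Y) ≫ μ_H` (base change
  commutes with fibre products, Cor. 4.19, compatibly with transitivity);
* `chart_comp_map_eq_of_left_comp_fst` — transport of a «chart equation» `l ≫ F(incl) = (g ⊗ g′) ≫ μ_F` from `k′` to `S`:
  `(μ_G ≫ G(l) ≫ e_N) ≫ H(incl) = ((G g ≫ e_X) ⊗ (G g′ ≫ e_Y)) ≫ μ_H` (the shape of the `α`-compatibility chart
  `E_c × E_c ⟶ ∇X ↪ X × X` of an Albanese datum moved from a finite Galois level to `ℂ`, [Liu2021] Lemma 2.4);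
and the hypothesis `e_X ≫ pr_X = pr ≫ pr_X` for the two comparison isomorphisms of the tree — the natural isomorphism
`bcFunctorTowerIso k k′ S` (`bcFunctorTowerIso_hom_app_left_comp_fst`) and the object-level
`baseChangeHomObjIsoOfComp (algebraMap k k′) (algebraMap k′ S) (algebraMap k S) h` (`baseChangeHomObjIsoOfComp_algebraMap_hom_left_comp_fst`) —
with the naturality and monoidality statements specialised to each (`…_bcFunctorTowerIso_hom_app`, `…_baseChangeHomObjIsoOfComp_hom`).

WHY AT SCHEME LEVEL (kernel note, measured on the farm 2026-08-28).  Mathlib's «natural transformations of cartesian functors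
are monoidal» (`NatTrans.IsMonoidal`) and the generic `Motives.NatIso.μ_comp_map_μ_comp_hom_app` instantiate instantly, but a
hand-stated goal at a CONCRETE comparison isomorphism (`bcFunctorTowerIso`, `baseChangeHomObjIsoOfComp` — both `… ≪≫ eqToIso _`)
elaborates `Functor.LaxMonoidal.μ (bcFunctor _ _)` through a different, definitionally equal instance path, and the kernel's
conversion then unfolds the isomorphism: «(kernel) deterministic timeout» (90 s, reproducible; also when the statement is
instantiated at a tensor object `X ⊗ Y`).  Here every proof is a computation against the projections of `Limits.pullback`
(`pullback.hom_ext`, Mathlib `Over.μ_pullback_left_fst_fst` …) in the spelling consumers elaborate, and the comparison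
morphisms enter ONLY through the hypothesis `e ≫ pr = pr ≫ pr`; the §3 instantiations (tensor objects included) check in
seconds.  USAGE: to close YOUR goal by `exact`, apply a §2 statement to your own morphisms `eX.hom, …` together with the §3
`…_left_comp_fst` lemmas (the proof term is then a substitution instance of your goal); the §3 corollaries are stated with
`(bcFunctorTowerIso k k′ S).hom.app X` / `(baseChangeHomObjIsoOfComp … X).hom` components.

## References
* [GortzWedhorn2020] U. Görtz, T. Wedhorn, *Algebraic Geometry I* (2nd ed. 2020): Prop. 4.16 (transitivity of fibre products),
  §(4.7)–(4.8) (base change functor), Cor. 4.19 (fibre products commute with base change).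
* [Liu2021] Y. Liu, *Fourier–Jacobi cycles and arithmetic relative trace formula*, Camb. J. Math. 9 (2021), Lemma 2.4 (the consumer).
-/

noncomputable section

open CategoryTheory CategoryTheory.Limits AlgebraicGeometry MonoidalCategory CartesianMonoidalCategory

universe u

namespace Literature.AlgebraicGeometry.Motives

namespace AbelianVariety

set_option backward.isDefEq.respectTransparency false

/-! ## §1 One base change `- ⊗_k S`: the tensor structure against the projections of `Limits.pullback` -/

section OneStep

variable (k S : Type u) [Field k] [Field S] [Algebra k S]

/-- `μ ≫ pr₁ ≫ pr₁ = pr₁ ≫ pr₁` on underlying schemes for `μ : X_S ⊗ Y_S ⟶ (X ⊗ Y)_S` (Mathlib `Over.μ_pullback_left_fst_fst`,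
restated for `bcFunctor`). [cite: GortzWedhorn2020, Cor. 4.19 and §(4.7)] -/
@[reassoc]
theorem μ_bcFunctor_left_fst_fst (X Y : SchemeOver k) :
    (Functor.LaxMonoidal.μ (bcFunctor k S) X Y).left ≫ pullback.fst (X ⊗ Y).hom (bcSpec k S) ≫
        pullback.fst X.hom Y.hom =
      pullback.fst ((bcFunctor k S).obj X).hom ((bcFunctor k S).obj Y).hom ≫ pullback.fst X.hom (bcSpec k S) := by
  exact Over.μ_pullback_left_fst_fst X Y

/-- `μ ≫ pr₁ ≫ pr₂ = pr₂ ≫ pr₁` on underlying schemes (Mathlib `Over.μ_pullback_left_fst_snd`). [cite: GortzWedhorn2020, Cor. 4.19 and §(4.7)] -/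
@[reassoc]
theorem μ_bcFunctor_left_fst_snd (X Y : SchemeOver k) :
    (Functor.LaxMonoidal.μ (bcFunctor k S) X Y).left ≫ pullback.fst (X ⊗ Y).hom (bcSpec k S) ≫
        pullback.snd X.hom Y.hom =
      pullback.snd ((bcFunctor k S).obj X).hom ((bcFunctor k S).obj Y).hom ≫ pullback.fst Y.hom (bcSpec k S) := by
  exact Over.μ_pullback_left_fst_snd X Y

/-- `μ ≫ pr₂ = pr₂ ≫ pr₂` on underlying schemes: `μ` is a morphism over `Spec S` (Mathlib `Over.μ_pullback_left_snd`).
[cite: GortzWedhorn2020, Cor. 4.19 and §(4.7)] -/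
@[reassoc]
theorem μ_bcFunctor_left_snd (X Y : SchemeOver k) :
    (Functor.LaxMonoidal.μ (bcFunctor k S) X Y).left ≫ pullback.snd (X ⊗ Y).hom (bcSpec k S) =
      pullback.snd ((bcFunctor k S).obj X).hom ((bcFunctor k S).obj Y).hom ≫
        pullback.snd Y.hom (bcSpec k S) := by
  exact Over.μ_pullback_left_snd X Y

/-- `(f ⊗ g) ≫ pr₁ = pr₁ ≫ f` on underlying schemes (`Sch/S` is cartesian monoidal for `Limits.pullback`).
[cite: GortzWedhorn2020, §(4.7)] -/
@[reassoc]
theorem tensorHom_left_comp_fst {X' Y' Z W : SchemeOver S} (f : X' ⟶ Z) (g : Y' ⟶ W) :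
    (f ⊗ₘ g).left ≫ pullback.fst Z.hom W.hom = pullback.fst X'.hom Y'.hom ≫ f.left := by
  have h := congrArg CommaMorphism.left (tensorHom_fst f g)
  simp only [Over.comp_left, Over.fst_left] at h
  exact h

/-- `(f ⊗ g) ≫ pr₂ = pr₂ ≫ g` on underlying schemes. [cite: GortzWedhorn2020, §(4.7)] -/
@[reassoc]
theorem tensorHom_left_comp_snd {X' Y' Z W : SchemeOver S} (f : X' ⟶ Z) (g : Y' ⟶ W) :
    (f ⊗ₘ g).left ≫ pullback.snd Z.hom W.hom = pullback.snd X'.hom Y'.hom ≫ g.left := by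
  have h := congrArg CommaMorphism.left (tensorHom_snd f g)
  simp only [Over.comp_left, Over.snd_left] at h
  exact h

end OneStep

/-! ## §2 The tower `k → k′ → S`: comparison morphisms over the first projections are natural and monoidal -/

section Tower

variable (k k' S : Type u) [Field k] [Field k'] [Field S] [Algebra k k'] [Algebra k' S] [Algebra k S]

/-- **Naturality.**  Comparison morphisms `e_W : (W ⊗_k k′) ⊗_{k′} S ⟶ W ⊗_k S` over the first projections
(`e_W ≫ pr_W = pr ≫ pr_W`) commute with base-changed morphisms: `(f ⊗ k′) ⊗ S ≫ e_Z = e_W ≫ (f ⊗ S)` — both sides have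
the same two projections. [cite: GortzWedhorn2020, Prop. 4.16 and §(4.8)] -/
@[reassoc]
theorem map_map_comp_eq_comp_map_of_left_comp_fst {W Z : SchemeOver k} (f : W ⟶ Z)
    (eW : (bcFunctor k' S).obj ((bcFunctor k k').obj W) ⟶ (bcFunctor k S).obj W)
    (eZ : (bcFunctor k' S).obj ((bcFunctor k k').obj Z) ⟶ (bcFunctor k S).obj Z)
    (hW : eW.left ≫ pullback.fst W.hom (bcSpec k S) =
      pullback.fst ((bcFunctor k k').obj W).hom (bcSpec k' S) ≫ pullback.fst W.hom (bcSpec k k'))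
    (hZ : eZ.left ≫ pullback.fst Z.hom (bcSpec k S) =
      pullback.fst ((bcFunctor k k').obj Z).hom (bcSpec k' S) ≫ pullback.fst Z.hom (bcSpec k k')) :
    (bcFunctor k' S).map ((bcFunctor k k').map f) ≫ eZ = eW ≫ (bcFunctor k S).map f := by
  ext
  apply pullback.hom_ext
  · simp only [Over.comp_left, Category.assoc, hZ, bcFunctor_map_left_fst, bcFunctor_map_left_fst_assoc,
      reassoc_of% hW]
  · rw [show pullback.snd Z.hom (bcSpec k S) = ((bcFunctor k S).obj Z).hom from rfl, Over.w, Over.w]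

/-- **Monoidality (base change commutes with fibre products, compatibly with transitivity).**  For comparison morphisms
`e_X, e_Y, e_{X ⊗ Y}` over the first projections: `μ_{k′,S} ≫ (μ_{k,k′})_S ≫ e_{X ⊗ Y} = (e_X ⊗ e_Y) ≫ μ_{k,S}` — both
sides have the projections `pr ≫ pr ≫ pr_X`, `pr ≫ pr ≫ pr_Y`. [cite: GortzWedhorn2020, Prop. 4.16 and Cor. 4.19] -/
@[reassoc]
theorem μ_comp_map_μ_comp_eq_of_left_comp_fst (X Y : SchemeOver k)
    (eX : (bcFunctor k' S).obj ((bcFunctor k k').obj X) ⟶ (bcFunctor k S).obj X)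
    (eY : (bcFunctor k' S).obj ((bcFunctor k k').obj Y) ⟶ (bcFunctor k S).obj Y)
    (eXY : (bcFunctor k' S).obj ((bcFunctor k k').obj (X ⊗ Y)) ⟶ (bcFunctor k S).obj (X ⊗ Y))
    (hX : eX.left ≫ pullback.fst X.hom (bcSpec k S) =
      pullback.fst ((bcFunctor k k').obj X).hom (bcSpec k' S) ≫ pullback.fst X.hom (bcSpec k k'))
    (hY : eY.left ≫ pullback.fst Y.hom (bcSpec k S) =
      pullback.fst ((bcFunctor k k').obj Y).hom (bcSpec k' S) ≫ pullback.fst Y.hom (bcSpec k k'))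
    (hXY : eXY.left ≫ pullback.fst (X ⊗ Y).hom (bcSpec k S) =
      pullback.fst ((bcFunctor k k').obj (X ⊗ Y)).hom (bcSpec k' S) ≫ pullback.fst (X ⊗ Y).hom (bcSpec k k')) :
    Functor.LaxMonoidal.μ (bcFunctor k' S) ((bcFunctor k k').obj X) ((bcFunctor k k').obj Y) ≫
        (bcFunctor k' S).map (Functor.LaxMonoidal.μ (bcFunctor k k') X Y) ≫ eXY =
      (eX ⊗ₘ eY) ≫ Functor.LaxMonoidal.μ (bcFunctor k S) X Y := by
  ext
  apply pullback.hom_ext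
  · apply pullback.hom_ext
    · simp only [Category.assoc, Over.comp_left, reassoc_of% hXY, bcFunctor_map_left_fst_assoc,
        μ_bcFunctor_left_fst_fst, μ_bcFunctor_left_fst_fst_assoc, tensorHom_left_comp_fst_assoc, hX]
    · simp only [Category.assoc, Over.comp_left, reassoc_of% hXY, bcFunctor_map_left_fst_assoc,
        μ_bcFunctor_left_fst_snd, μ_bcFunctor_left_fst_snd_assoc, tensorHom_left_comp_snd_assoc, hY]
  · rw [show pullback.snd (X ⊗ Y).hom (bcSpec k S) = ((bcFunctor k S).obj (X ⊗ Y)).hom from rfl, Over.w, Over.w]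

/-- **Transport of a chart equation along the tower.**  If `l : Z ⊗ Z′ ⟶ N ⊗_k k′` lifts `g ⊗ g′` through
`incl : N ⟶ X ⊗ Y` over `k′` (`l ≫ (incl ⊗ k′) = (g ⊗ g′) ≫ μ_{k,k′}`), then over `S` the chart
`μ_{k′,S} ≫ (l ⊗ S) ≫ e_N` lifts `(g ⊗ S ≫ e_X) ⊗ (g′ ⊗ S ≫ e_Y)` through `incl ⊗ S` — for comparison morphisms over the
first projections (the shape of the `α`-compatibility chart `E_c × E_c ⟶ ∇X ↪ X × X` of an Albanese datum moved from a
finite level `L` to `ℂ`). [cite: GortzWedhorn2020, Prop. 4.16 and Cor. 4.19] -/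
theorem chart_comp_map_eq_of_left_comp_fst {X Y N : SchemeOver k} {Z Z' : SchemeOver k'}
    (g : Z ⟶ (bcFunctor k k').obj X) (g' : Z' ⟶ (bcFunctor k k').obj Y) (incl : N ⟶ X ⊗ Y)
    (l : Z ⊗ Z' ⟶ (bcFunctor k k').obj N)
    (hl : l ≫ (bcFunctor k k').map incl = (g ⊗ₘ g') ≫ Functor.LaxMonoidal.μ (bcFunctor k k') X Y)
    (eX : (bcFunctor k' S).obj ((bcFunctor k k').obj X) ⟶ (bcFunctor k S).obj X)
    (eY : (bcFunctor k' S).obj ((bcFunctor k k').obj Y) ⟶ (bcFunctor k S).obj Y)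
    (eXY : (bcFunctor k' S).obj ((bcFunctor k k').obj (X ⊗ Y)) ⟶ (bcFunctor k S).obj (X ⊗ Y))
    (eN : (bcFunctor k' S).obj ((bcFunctor k k').obj N) ⟶ (bcFunctor k S).obj N)
    (hX : eX.left ≫ pullback.fst X.hom (bcSpec k S) =
      pullback.fst ((bcFunctor k k').obj X).hom (bcSpec k' S) ≫ pullback.fst X.hom (bcSpec k k'))
    (hY : eY.left ≫ pullback.fst Y.hom (bcSpec k S) =
      pullback.fst ((bcFunctor k k').obj Y).hom (bcSpec k' S) ≫ pullback.fst Y.hom (bcSpec k k'))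
    (hXY : eXY.left ≫ pullback.fst (X ⊗ Y).hom (bcSpec k S) =
      pullback.fst ((bcFunctor k k').obj (X ⊗ Y)).hom (bcSpec k' S) ≫ pullback.fst (X ⊗ Y).hom (bcSpec k k'))
    (hN : eN.left ≫ pullback.fst N.hom (bcSpec k S) =
      pullback.fst ((bcFunctor k k').obj N).hom (bcSpec k' S) ≫ pullback.fst N.hom (bcSpec k k')) :
    (Functor.LaxMonoidal.μ (bcFunctor k' S) Z Z' ≫ (bcFunctor k' S).map l ≫ eN) ≫ (bcFunctor k S).map incl =
      (((bcFunctor k' S).map g ≫ eX) ⊗ₘ ((bcFunctor k' S).map g' ≫ eY)) ≫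
        Functor.LaxMonoidal.μ (bcFunctor k S) X Y := by
  rw [Category.assoc, Category.assoc,
    ← map_map_comp_eq_comp_map_of_left_comp_fst k k' S incl eN eXY hN hXY, ← Functor.map_comp_assoc, hl,
    Functor.map_comp_assoc, ← Functor.LaxMonoidal.μ_natural_assoc,
    μ_comp_map_μ_comp_eq_of_left_comp_fst k k' S X Y eX eY eXY hX hY hXY, ← Category.assoc,
    tensorHom_comp_tensorHom]

end Tower

/-! ## §3 The two comparison isomorphisms of the tree are over the first projections -/

section Instances

variable (k k' S : Type u) [Field k] [Field k'] [Field S] [Algebra k k'] [Algebra k' S] [Algebra k S]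

/-- The component of the natural isomorphism `bcFunctorTowerIso k k′ S : (- ⊗_k k′) ⊗_{k′} S ≅ - ⊗_k S` at `W` lies over
the first projections: `e_W ≫ pr_W = pr ≫ pr_W` (from `pullbackComp_symm_trans_congr_hom_app_left_comp_fst`).
[cite: GortzWedhorn2020, Prop. 4.16 and §(4.8)] -/
@[reassoc]
theorem bcFunctorTowerIso_hom_app_left_comp_fst [IsScalarTower k k' S] (W : SchemeOver k) :
    ((bcFunctorTowerIso k k' S).hom.app W).left ≫ pullback.fst W.hom (bcSpec k S) =
      pullback.fst ((bcFunctor k k').obj W).hom (bcSpec k' S) ≫ pullback.fst W.hom (bcSpec k k') := by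
  rw [show bcFunctorTowerIso k k' S = (Over.pullbackComp (bcSpec k' S) (bcSpec k k')).symm ≪≫
      overPullbackCongr (bcSpec_comp_bcSpec_of_isScalarTower k k' S) from rfl]
  exact pullbackComp_symm_trans_congr_hom_app_left_comp_fst (bcSpec_comp_bcSpec_of_isScalarTower k k' S) W

/-- The object-level transitivity isomorphism `baseChangeHomObjIsoOfComp (algebraMap k k′) (algebraMap k′ S) (algebraMap k S) h W`
(`Motives/FiberBaseChange`) lies over the first projections, in the `bcFunctor`/`Limits.pullback` spelling
(`baseChangeHomObjIsoOfComp_hom_left_fst`). [cite: GortzWedhorn2020, Prop. 4.16 and §(4.7)] -/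
@[reassoc]
theorem baseChangeHomObjIsoOfComp_algebraMap_hom_left_comp_fst
    (h : (algebraMap k' S).comp (algebraMap k k') = algebraMap k S) (W : SchemeOver k) :
    (baseChangeHomObjIsoOfComp (algebraMap k k') (algebraMap k' S) (algebraMap k S) h W).hom.left ≫
        pullback.fst W.hom (bcSpec k S) =
      pullback.fst ((bcFunctor k k').obj W).hom (bcSpec k' S) ≫ pullback.fst W.hom (bcSpec k k') := by
  exact baseChangeHomObjIsoOfComp_hom_left_fst _ _ _ h W

/-- Monoidality of the natural isomorphism `bcFunctorTowerIso k k′ S` (components spelled `e.hom.app`, objects nested):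
`μ_{k′,S} ≫ (μ_{k,k′})_S ≫ e_{X ⊗ Y} = (e_X ⊗ e_Y) ≫ μ_{k,S}`. [cite: GortzWedhorn2020, Prop. 4.16 and Cor. 4.19] -/
@[reassoc]
theorem μ_comp_map_μ_comp_bcFunctorTowerIso_hom_app [IsScalarTower k k' S] (X Y : SchemeOver k) :
    Functor.LaxMonoidal.μ (bcFunctor k' S) ((bcFunctor k k').obj X) ((bcFunctor k k').obj Y) ≫
        (bcFunctor k' S).map (Functor.LaxMonoidal.μ (bcFunctor k k') X Y) ≫
          (bcFunctorTowerIso k k' S).hom.app (X ⊗ Y) =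
      ((bcFunctorTowerIso k k' S).hom.app X ⊗ₘ (bcFunctorTowerIso k k' S).hom.app Y) ≫
        Functor.LaxMonoidal.μ (bcFunctor k S) X Y :=
  μ_comp_map_μ_comp_eq_of_left_comp_fst k k' S X Y _ _ _ (bcFunctorTowerIso_hom_app_left_comp_fst k k' S X)
    (bcFunctorTowerIso_hom_app_left_comp_fst k k' S Y) (bcFunctorTowerIso_hom_app_left_comp_fst k k' S (X ⊗ Y))

/-- Naturality of `bcFunctorTowerIso k k′ S` in the NESTED spelling `(- ⊗ S).map ((- ⊗ k′).map f)` (the composite-functor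
spelling is `(bcFunctorTowerIso k k′ S).hom.naturality f`). [cite: GortzWedhorn2020, Prop. 4.16 and §(4.8)] -/
@[reassoc]
theorem map_map_comp_bcFunctorTowerIso_hom_app [IsScalarTower k k' S] {W Z : SchemeOver k} (f : W ⟶ Z) :
    (bcFunctor k' S).map ((bcFunctor k k').map f) ≫ (bcFunctorTowerIso k k' S).hom.app Z =
      (bcFunctorTowerIso k k' S).hom.app W ≫ (bcFunctor k S).map f :=
  map_map_comp_eq_comp_map_of_left_comp_fst k k' S f _ _ (bcFunctorTowerIso_hom_app_left_comp_fst k k' S W)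
    (bcFunctorTowerIso_hom_app_left_comp_fst k k' S Z)

/-- Monoidality of the object-level transitivity isomorphisms `baseChangeHomObjIsoOfComp (algebraMap k k′) (algebraMap k′ S)
(algebraMap k S) h`: `μ_{k′,S} ≫ (μ_{k,k′})_S ≫ e_{X ⊗ Y} = (e_X ⊗ e_Y) ≫ μ_{k,S}`. [cite: GortzWedhorn2020, Prop. 4.16 and Cor. 4.19] -/
@[reassoc]
theorem μ_comp_map_μ_comp_baseChangeHomObjIsoOfComp_hom
    (h : (algebraMap k' S).comp (algebraMap k k') = algebraMap k S) (X Y : SchemeOver k) :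
    Functor.LaxMonoidal.μ (bcFunctor k' S) ((bcFunctor k k').obj X) ((bcFunctor k k').obj Y) ≫
        (bcFunctor k' S).map (Functor.LaxMonoidal.μ (bcFunctor k k') X Y) ≫
          (baseChangeHomObjIsoOfComp (algebraMap k k') (algebraMap k' S) (algebraMap k S) h (X ⊗ Y)).hom =
      ((baseChangeHomObjIsoOfComp (algebraMap k k') (algebraMap k' S) (algebraMap k S) h X).hom ⊗ₘ
          (baseChangeHomObjIsoOfComp (algebraMap k k') (algebraMap k' S) (algebraMap k S) h Y).hom) ≫
        Functor.LaxMonoidal.μ (bcFunctor k S) X Y :=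
  μ_comp_map_μ_comp_eq_of_left_comp_fst k k' S X Y _ _ _
    (baseChangeHomObjIsoOfComp_algebraMap_hom_left_comp_fst k k' S h X)
    (baseChangeHomObjIsoOfComp_algebraMap_hom_left_comp_fst k k' S h Y)
    (baseChangeHomObjIsoOfComp_algebraMap_hom_left_comp_fst k k' S h (X ⊗ Y))

/-- Naturality of `baseChangeHomObjIsoOfComp (algebraMap k k′) (algebraMap k′ S) (algebraMap k S) h` in the `bcFunctor` spelling
(the `baseChangeHom` spelling is `baseChangeHomObjIsoOfComp_comm`). [cite: GortzWedhorn2020, Prop. 4.16 and §(4.8)] -/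
@[reassoc]
theorem map_map_comp_baseChangeHomObjIsoOfComp_hom
    (h : (algebraMap k' S).comp (algebraMap k k') = algebraMap k S) {W Z : SchemeOver k} (f : W ⟶ Z) :
    (bcFunctor k' S).map ((bcFunctor k k').map f) ≫
        (baseChangeHomObjIsoOfComp (algebraMap k k') (algebraMap k' S) (algebraMap k S) h Z).hom =
      (baseChangeHomObjIsoOfComp (algebraMap k k') (algebraMap k' S) (algebraMap k S) h W).hom ≫
        (bcFunctor k S).map f :=
  map_map_comp_eq_comp_map_of_left_comp_fst k k' S f _ _
    (baseChangeHomObjIsoOfComp_algebraMap_hom_left_comp_fst k k' S h W)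
    (baseChangeHomObjIsoOfComp_algebraMap_hom_left_comp_fst k k' S h Z)

end Instances

end AbelianVariety

end Literature.AlgebraicGeometry.Motives

end
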